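import Literature.MathematicalPhysics.QuantumFieldTheory.Balaban1983to89.T4TubeBudget
import Literature.MathematicalPhysics.QuantumFieldTheory.Balaban1983to89.T4FirstOrderSize

/-!
# T4 — THE TERM FORMAT of the hierarchical booking (T4-DAG v3 §5 row T4-O3.E-iii-a): a typed home, no estimate

Cell `pub-balaban` (audit/reconstruction of Bałaban's lattice Yang–Mills series; host summit YangMills; NOT summit
work).  Row text (T4-DAG v3 §5, verbatim): "THE FORMAT as a Lean structure (T4-REF-O3 V4): the exponent-term class at
scale k = Bałaban's terms of (2.18)/(I.1.3) (E^{(j)}(X), R^{(j)}, boundary terms — abstract carriers indexed by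
localisation domains with the factor-format weight E₀e^{−κd_j(X)}) ⊕ D-terms indexed by (birth scale j, component Λ_i,
loop C) with carrier = (function of the scale-j fluctuation field on X_i^L) × (bounded function of the block-field
tower above X_i^L), ORDINARY d_j(X_i^L), sizes s_j^{(k)} abstract; the budget (TOB-k) as a `Prop` (`TubeBudget`, shared
with row O3b.B); the pair class of O3.E-ii as a second index type with a Mayer-criterion `Prop`; a μ-analyticity slot;
NO estimate — this is the typed home O3.E-iii-b/ -c and U5b.E quantify over" (one space inserted after "-b/" only
to avoid the Lean comment opener; otherwise verbatim).

HONEST FRAMING.  Nothing in this file is a statement of Bałaban's papers and nothing here is asserted about his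
expansions: the file fixes TYPES (index sets, size arrays, carriers) and PREDICATES (budget, counts, Mayer smallness,
analyticity slot, factor-format weight) that later rows instantiate and prove things about, plus the finite-sum
bookkeeping that turns per-term sizes and positional counts into the aggregated array `s j k` consumed by
`T4TubeBudget.TubeBudget` (row T4-O3b.B, pv21-g3).  Every predicate is a HYPOTHESIS SHAPE; the kernel content is
[folklore] (fiberwise finite sums, an induction on the current scale).  ABSOLUTE RULE honoured: no internally minted
statement is cited as a fact; the printed context below is quoted (renders read as images by this seat) for context only.

PRINTED CONTEXT (verbatim; [R pNNN] = render `b2b-balaban-ref1/pages/<stem>/<stem>-pNNN-x2.png`).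
* [Balaban1987RG1] p. 260 [R p012]: *"The k-th action A_k(V) depends on V through the minimal configuration U_k(V),
  A_k(V) = A_k(U_k(V))."* and (1.3) *"A_k(U_k) = −(1/g_k²)A(U_k) + Σ_{j=0}^{k−1}{−β_{j+1}(g_j)A(U_k) + [log Z^{(j)}(U_k) −
  log Z^{(j)}(1)] + [E^{(j+1)}(g_j, U_k) − E^{(j+k)}(g_j, 1)]}. (1.3)"* [sic: the last superscript prints (j+k)];
  p. 261 [R p013]: (1.7) *"E^{(j)}(g_{j−1}, U_j) = Σ_{X∈D_j} E^{(j)}(X, g_{j−1}, U_j). (1.7) Again, the term corresponding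
  to a domain X depends on U_j restricted to X."* … *"Thus we assume that there are functions E^{(j)}(X, g_{j−1}, U, J),
  analytic on a space of regular, complex configurations U, J, such that E^{(j)}(X, g_{j−1}, U_j) = E^{(j)}(X, g_{j−1},
  U_j, J_j). (1.9)"*; p. 263 [R p015]: *"We assume that the function E^{(j)}(X, g_{j−1}, U, J) is defined and analytic on
  the space U^c_j(X, α₀, α₁), with some positive, absolute constants α₀, α₁ (i.e., constants independent of X and j). It
  depends on the configurations restricted to X, i.e. on (U, J)|_X. It is a C^∞-function of g_{j−1} ∈ [0, γ], (or
  analytic), with a positive, absolute γ. There exists a constant E₀ such that |E^{(j)}(X, g_{j−1}, U, J)| ≤ E₀ exp(−κd_j(X))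
  (1.18) for M ≥ M(κ), γ sufficiently small, and for all configurations (U, J) ∈ U^c_j(X, α₀, α₁)."*
* [Balaban1988RG2Cluster] p. 16 [R p016], end of (2.20): *"… ≤ ½O(1)α₄Σ_{b⊂Y₀}|B(b)|² + O(1)α₄M⁻⁴|Y₀|. (2.20)"*, the
  quadratic form being *"resummed over all Y∈D_k containing, for example, the point b₋"* — the PER-POINT locus behind
  the cell's budget (TOB-k) (T4-REF-O3 V2 (c): a located necessary condition, cell analysis, NOT PRINTED as a budget).
* [Balaban1988Convergent] p. 257 [R p015]: (2.18) *"ρ_k(V_k) = Σ_{{Ω_j},{Λ_j}} χ_k(Ω_k)T_k({Ω_j},{Λ_j}) exp A_k(1/g_k², U_k),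
  (2.18) where the summation is over the admissible sequences of domains. Summation over the sequences {S_j} is included
  in the operation T_k, and the effective action A_k depends on the sequences {Ω_j}, {Λ_j}, {S_j}."*
(The row's source column writes "(1.3)/(1.7) p.261"; (1.3) is printed on p. 260 — cited here as read.)

THE CELL'S USE (T4-REF-O3 V4, cell analysis, quoted from `t4/T4-REF-O3.md`): "(α) FIBRE CONSTANCY: … a D-term born at
(j, Λ_i) depends on the scale-j fluctuation variables only on X_i^L := Λ_i ∪ (the L-blocks of level j+1 meeting Λ_i) …
and on everything else only through V_{j+1} = avg V_j and its further averages along the branch of blocks above X_i^L;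
at each later scale k the same term depends on the then-current fluctuation variables only on the few k-cubes of that
branch. (β) … a D-term is a function of (fluctuation field on X_i^L) × (analytic function of the block-field tower above
X_i^L, on the analyticity domains), carrying the ORDINARY d_j(X_i^L) … what is left of the falsifier is exactly the
budget (TOB-k) — which counts birth positions under a k-cube"; and V2 (c): "(TOB-k) for every scale k ≤ K and every tube
M-cube □ ∈ 𝒯_k: Σ_{j ≤ k} Σ_{(j,i): D-term born at (j, Λ_i) and felt at □ at scale k} g_j^{κ₀′}·s_j^{(k)}(i) ≤ c₀·α₄".

WHAT IS TYPED.  §1 `Booking` — the index data: localisation domains with scale and tree length and Bałaban's own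
term sizes (`balSize`, weight predicate `FactorFormat E₀ κ` = the (1.18) SHAPE); D-term births with birth scale and
localisation domain X_i^L (`loc`, `loc_scale`); tube cubes with scale; `feltAt q` = the finite set of births felt at
cube `q` (birth scale ≤ cube scale); the size array `size b k` (nonnegative); pair strengths `pair b b′ k`.  §2 the
per-cube LOAD `load q j` and the budget `CubeBudget w c` = (TOB-k) literally, per cube; `PositionalCount N` (births of
scale j felt at a k-cube ≤ N j k), `BranchLocal m₀` (a birth is felt at ≤ m₀ cubes of each scale — V4 (α)),
`SizeBound σ`; the aggregation `sum_feltAt_le` / `load_le` and **`cubeBudget_of_tubeBudget`**: `PositionalCount N`,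
`SizeBound σ` and `T4TubeBudget.TubeBudget K w (fun j k => N j k * σ j k) c` give `CubeBudget w c`; the rate corollary
`cubeBudget_of_rate` / `cubeBudget_of_twoRate` (v1.1) through `T4TubeBudget.tubeBudget_of_rate`; `sizeBound_of_step` (birth bound + one-step
preservation ⇒ `SizeBound`, the induction O3.E-iii-b, -iii-c will run).  §3 the pair class: `alive k`, `MayerSmall u ε`
(X2 obligation (A) shape sup_b Σ_{b′} |pair b b′ k|·u b′ ≤ ε) and its monotonicity; the quadratic-currency slot
`EtaBudget η η₀` (total (2.20)-currency drawn at a cube, cf. `T4FirstOrderSize.LinearAbsorbed`) with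
`etaBudget_of_count`.  §4 `Carrier` — the V4 (β) carrier shape (fluctuation configurations on X_i^L, tower
configurations with a domain slot, a value `val b μ ψ τ : ℂ`, a radius μ₀) with the slots `MuAnalytic` (analytic in μ
on the ball of radius μ₀, as `DifferentiableOn ℂ`) and `BirthSizeDominates` (|val| ≤ birth size on the domain).  §5 the
empty booking `vacuum K` meets every predicate with constant 0 (non-vacuity of the shapes, nothing more).

NOT TYPED / NOT CLAIMED: any size, rate, count or radius (all abstract); that Bałaban's terms or the cell's D-terms fit
this format (rows O3.E-iii-b, -iii-c, U5b.E); the R^{(j)} / boundary-term kinds beyond the single `balSize` array (a consumer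
adds kinds as `T4RecentScale.Kind` does); the geometry of X_i^L, of branches and of tubes (only their counting shadows
`PositionalCount` / `BranchLocal`); the (2.20) resummation itself; anything about (TOB-k) being sufficient.
Interfaces: `T4TubeBudget.TubeBudget` / `tubeBudget_of_rate` consumed BY NAME (not restated); `T4FirstOrderSize`
supplies birth sizes (`FirstOrderSize`, `AbsorbedCostSize`) and the currency vocabulary; `T4JointDressing.LoopPairOscBound`
(pv18-g3) is the intended supplier of `pair` strengths — not imported (heavy), named only.
Versions: v1 = p180102 (row landing); v1.1 = + `Booking.cubeBudget_of_twoRate` (count rate and size gain kept apart) and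
the corrected (β2) parenthetical of `cubeBudget_of_rate` — additive, no v1 declaration changed; v1.2 = + §4b
`Booking.CarrierAt` (later-scale carrier `valAt b k`, slots `MuAnalyticAt` / `NormBound` / `SizeDominatesAt` /
`OneStepBound`, `birthSizeDominates_of_sizeDominatesAt`, the function-level induction `normBound_of_step`,
`norm_valAt_le`) per the cross-read C-pv27-20 (d2)/(d3) — additive, nothing earlier changed.
-/

namespace Literature.MathematicalPhysics.QuantumFieldTheory.Balaban1983to89.T4TermFormat

open Finset
open scoped BigOperators

/-! ## §1 The booking data -/

/-- THE BOOKING (T4-REF-O3 V4, cell analysis; a TYPE, nothing asserted): index data of the hierarchical format at final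
scale `K` — localisation domains (scale, tree length, size of Bałaban's own term there), D-term births (birth scale,
localisation domain X_i^L), tube cubes (scale, the finite set of births felt there), the size array `size b k` = "the
size the format proves AT SCALE k for the term born at b", and pair strengths.  All finite-volume: `births`, `cubes`
enumerate everything. [folklore] -/
structure Booking where
  /-- number of RG steps; the final unit lattice is scale `K` -/
  K : ℕ
  /-- localisation domains of all scales (Bałaban's `X ∈ D_j`, and the `X_i^L` of D-terms) -/
  Dom : Type
  /-- the scale `j` of a domain -/
  domScale : Dom → ℕ
  /-- tree length `d_j(X)` -/
  treeLen : Dom → ℝ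
  treeLen_nonneg : ∀ X, 0 ≤ treeLen X
  /-- size of Bałaban's own exponent term with domain `X` (sup over its analyticity domain; abstract) -/
  balSize : Dom → ℝ
  /-- D-term births `(j, Λ_i, C)` -/
  Birth : Type
  births : Finset Birth
  mem_births : ∀ b, b ∈ births
  /-- birth scale `j` -/
  birthScale : Birth → ℕ
  birth_le : ∀ b, birthScale b ≤ K
  /-- localisation domain `X_i^L` of the birth, of the birth scale (ORDINARY tree length, V4 (β)) -/
  loc : Birth → Dom
  loc_scale : ∀ b, domScale (loc b) = birthScale b
  /-- tube cubes of all scales -/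
  Cube : Type
  cubes : Finset Cube
  mem_cubes : ∀ q, q ∈ cubes
  /-- the scale `k` of a cube -/
  cubeScale : Cube → ℕ
  cube_le : ∀ q, cubeScale q ≤ K
  /-- the births FELT at a cube (V2 (c): "born at (j, Λ_i) and felt at □ at scale k") -/
  feltAt : Cube → Finset Birth
  felt_birth_le : ∀ q, ∀ b ∈ feltAt q, birthScale b ≤ cubeScale q
  /-- `size b k` = size at current scale `k` of the term born at `b` (meaningful for `birthScale b ≤ k ≤ K`) -/
  size : Birth → ℕ → ℝ
  size_nonneg : ∀ b k, 0 ≤ size b k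
  /-- pair strength at scale `k` between the terms born at `b`, `b′` (the O3.E-ii class; abstract) -/
  pair : Birth → Birth → ℕ → ℝ

namespace Booking

variable (B : Booking)

/-- HYPOTHESIS SHAPE — FACTOR FORMAT of Bałaban's own terms: `|balSize X| ≤ E₀·exp(−κ·d(X))`, the SHAPE of (1.18)
(*"There exists a constant E₀ such that |E^{(j)}(X, g_{j−1}, U, J)| ≤ E₀ exp(−κd_j(X))"*); a predicate on the abstract
array, NOT an assertion about Bałaban's functions. [cite: Balaban1987RG1, (1.18) p. 263] -/
def FactorFormat (E₀ κ : ℝ) : Prop :=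
  ∀ X : B.Dom, |B.balSize X| ≤ E₀ * Real.exp (-κ * B.treeLen X)

/-! ## §2 Loads, counts, the budget per cube, and the aggregation to `TubeBudget` -/

/-- The births of scale `j` felt at cube `q`. [folklore] -/
def feltOfScale (q : B.Cube) (j : ℕ) : Finset B.Birth :=
  (B.feltAt q).filter (fun b => B.birthScale b = j)

/-- THE LOAD of birth scale `j` at cube `q`: `Σ_{b felt at q, born at scale j} size b (scale of q)` — the inner sum of
(TOB-k). [folklore] -/
def load (q : B.Cube) (j : ℕ) : ℝ :=
  ∑ b ∈ B.feltOfScale q j, B.size b (B.cubeScale q)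

/-- HYPOTHESIS SHAPE — THE BUDGET PER CUBE = (TOB-k) literally (T4-REF-O3 V2 (c), cell analysis, NOT PRINTED as a budget;
printed per-point locus: the (2.20) resummation *"over all Y∈D_k containing, for example, the point b₋"*): for every tube
cube `q` of scale `k`, `Σ_{j ≤ k} w j · load q j ≤ c`. [cite: Balaban1988RG2Cluster, (2.20) p. 16] -/
def CubeBudget (w : ℕ → ℝ) (c : ℝ) : Prop :=
  ∀ q : B.Cube, ∑ j ∈ range (B.cubeScale q + 1), w j * B.load q j ≤ c

/-- HYPOTHESIS SHAPE — POSITIONAL COUNT: at most `N j k` births of scale `j` are felt at any cube of scale `k` (V2 (c):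
"counts birth positions under a k-cube" — typically `(L⁴)^{k−j}` positions × a per-position component multiplicity). [folklore] -/
def PositionalCount (N : ℕ → ℕ → ℝ) : Prop :=
  ∀ (q : B.Cube) (j : ℕ), ((B.feltOfScale q j).card : ℝ) ≤ N j (B.cubeScale q)

open Classical in
/-- HYPOTHESIS SHAPE — BRANCH LOCALITY (V4 (α)): a birth is felt at no more than `m₀` cubes of any one scale (the k-cubes
of the branch of blocks above X_i^L).  (Classical decidability of membership.) [folklore] -/
def BranchLocal (m₀ : ℕ) : Prop :=
  ∀ (b : B.Birth) (k : ℕ), (B.cubes.filter (fun q => B.cubeScale q = k ∧ b ∈ B.feltAt q)).card ≤ m₀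

/-- HYPOTHESIS SHAPE — SIZE BOUND by an array in (birth scale, current scale): `size b k ≤ σ (birthScale b) k` for
`birthScale b ≤ k ≤ K`. [folklore] -/
def SizeBound (σ : ℕ → ℕ → ℝ) : Prop :=
  ∀ (b : B.Birth) (k : ℕ), B.birthScale b ≤ k → k ≤ B.K → B.size b k ≤ σ (B.birthScale b) k

variable {B}

/-- Membership in `feltOfScale`. [folklore] -/
theorem mem_feltOfScale {q : B.Cube} {j : ℕ} {b : B.Birth} :
    b ∈ B.feltOfScale q j ↔ b ∈ B.feltAt q ∧ B.birthScale b = j := by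
  simp [feltOfScale]

/-- AGGREGATION (fiberwise): a function on the births felt at `q`, bounded by a nonnegative profile of the birth scale,
sums to at most `Σ_{j ≤ k} N j k · φ j` under `PositionalCount N` (`k` = scale of `q`). [folklore] -/
theorem sum_feltAt_le {N : ℕ → ℕ → ℝ} (hN : B.PositionalCount N) (q : B.Cube) (f : B.Birth → ℝ) (φ : ℕ → ℝ)
    (hf : ∀ b ∈ B.feltAt q, f b ≤ φ (B.birthScale b)) (hφ : ∀ j, 0 ≤ φ j) :
    ∑ b ∈ B.feltAt q, f b ≤ ∑ j ∈ range (B.cubeScale q + 1), N j (B.cubeScale q) * φ j := by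
  have hmaps : ∀ b ∈ B.feltAt q, B.birthScale b ∈ range (B.cubeScale q + 1) := fun b hb =>
    mem_range.mpr (Nat.lt_succ_of_le (B.felt_birth_le q b hb))
  rw [← Finset.sum_fiberwise_of_maps_to hmaps]
  refine sum_le_sum fun j _ => ?_
  calc ∑ b ∈ (B.feltAt q).filter (fun b => B.birthScale b = j), f b
      ≤ ∑ b ∈ (B.feltAt q).filter (fun b => B.birthScale b = j), φ j := by
        refine sum_le_sum fun b hb => ?_
        obtain ⟨hb1, hb2⟩ := mem_filter.mp hb
        simpa [hb2] using hf b hb1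
    _ = (((B.feltAt q).filter (fun b => B.birthScale b = j)).card : ℝ) * φ j := by
        rw [sum_const, nsmul_eq_mul]
    _ ≤ N j (B.cubeScale q) * φ j := mul_le_mul_of_nonneg_right (hN q j) (hφ j)

/-- THE LOAD BOUND: `load q j ≤ N j k · σ j k` under `PositionalCount N` and `SizeBound σ` (`σ ≥ 0`, `k` = scale of `q`).
[folklore] -/
theorem load_le {N σ : ℕ → ℕ → ℝ} (hN : B.PositionalCount N) (hσ : B.SizeBound σ) (hσ0 : ∀ j k, 0 ≤ σ j k)
    (q : B.Cube) (j : ℕ) : B.load q j ≤ N j (B.cubeScale q) * σ j (B.cubeScale q) := by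
  unfold load
  calc ∑ b ∈ B.feltOfScale q j, B.size b (B.cubeScale q) ≤ ∑ b ∈ B.feltOfScale q j, σ j (B.cubeScale q) := by
        refine sum_le_sum fun b hb => ?_
        obtain ⟨hb1, hb2⟩ := mem_feltOfScale.mp hb
        have h := hσ b (B.cubeScale q) (B.felt_birth_le q b hb1) (B.cube_le q)
        rwa [hb2] at h
    _ = ((B.feltOfScale q j).card : ℝ) * σ j (B.cubeScale q) := by rw [sum_const, nsmul_eq_mul]
    _ ≤ N j (B.cubeScale q) * σ j (B.cubeScale q) := mul_le_mul_of_nonneg_right (hN q j) (hσ0 j _)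

/-- **AGGREGATION TO THE TUBE BUDGET**: positional counts `N`, a size bound `σ ≥ 0`, nonnegative weights and
`T4TubeBudget.TubeBudget K w (fun j k => N j k * σ j k) c` (row T4-O3b.B, consumed BY NAME) give the budget per cube.
This is the exact sense in which the aggregated array `s j k := N j k · σ j k` of `T4TubeBudget` "folds in the birth-place
sum". [folklore] -/
theorem cubeBudget_of_tubeBudget {N σ : ℕ → ℕ → ℝ} {w : ℕ → ℝ} {c : ℝ} (hw : ∀ j ≤ B.K, 0 ≤ w j)
    (hN : B.PositionalCount N) (hσ : B.SizeBound σ) (hσ0 : ∀ j k, 0 ≤ σ j k)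
    (hT : T4TubeBudget.TubeBudget B.K w (fun j k => N j k * σ j k) c) : B.CubeBudget w c := by
  intro q
  have hk : B.cubeScale q ≤ B.K := B.cube_le q
  calc ∑ j ∈ range (B.cubeScale q + 1), w j * B.load q j
      ≤ ∑ j ∈ range (B.cubeScale q + 1), w j * (N j (B.cubeScale q) * σ j (B.cubeScale q)) := by
        refine sum_le_sum fun j hj => ?_
        have hjk : j ≤ B.cubeScale q := Nat.lt_succ_iff.mp (mem_range.mp hj)
        exact mul_le_mul_of_nonneg_left (load_le hN hσ hσ0 q j) (hw j (hjk.trans hk))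
    _ ≤ c := hT (B.cubeScale q) hk

/-- **RATE COROLLARY** (via `T4TubeBudget.tubeBudget_of_rate`): counts `N j k ≤ N₀·Λ^{k−j}` and sizes
`σ j k ≤ A·τ^{K−j}` (`σ, N₀, A, Λ, τ ≥ 0`, `τ ≤ 1`, `Λτ ≤ 1`), nonnegative weights of total `≤ W`, give the budget
`(N₀·A)·W` at every cube.  This is the `φ = 1` case of `cubeBudget_of_twoRate` below; for the cell reading
G-pv16g4-7 (β2) of the first-order NE1′ sizes the COUNT rate is `Λ = L⁴` while the flatness gain `φ^{k−j}` sits in the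
SIZE (`σ j k ≤ A·φ^{k−j}·θ₁^{K−j}`), so that instance is `cubeBudget_of_twoRate` with `(Λ, φ, τ) = (L⁴, φ, θ₁)`,
`L⁴φθ₁ ≤ 1` (v1.1: v1's parenthetical put `φ` into `Λ`, which the count hypothesis `hNle` cannot carry). [folklore] -/
theorem cubeBudget_of_rate {N σ : ℕ → ℕ → ℝ} {w : ℕ → ℝ} {N₀ A Λ τ W : ℝ} (hw : ∀ j ≤ B.K, 0 ≤ w j)
    (hW : ∑ j ∈ range (B.K + 1), w j ≤ W) (hN : B.PositionalCount N) (hσ : B.SizeBound σ)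
    (hσ0 : ∀ j k, 0 ≤ σ j k) (hN₀ : 0 ≤ N₀) (hA : 0 ≤ A) (hΛ : 0 ≤ Λ)
    (hτ0 : 0 ≤ τ) (hτ1 : τ ≤ 1) (hΛτ : Λ * τ ≤ 1)
    (hNle : ∀ j k, j ≤ k → k ≤ B.K → N j k ≤ N₀ * Λ ^ (k - j))
    (hσle : ∀ j k, j ≤ k → k ≤ B.K → σ j k ≤ A * τ ^ (B.K - j)) :
    B.CubeBudget w ((N₀ * A) * W) := by
  refine cubeBudget_of_tubeBudget hw hN hσ hσ0 ?_
  refine T4TubeBudget.tubeBudget_of_rate hw hW (mul_nonneg hN₀ hA) hΛ hτ0 hτ1 hΛτ ?_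
  intro k hk j hjk
  calc N j k * σ j k ≤ (N₀ * Λ ^ (k - j)) * (A * τ ^ (B.K - j)) :=
        mul_le_mul (hNle j k hjk hk) (hσle j k hjk hk) (hσ0 j k)
          (mul_nonneg hN₀ (pow_nonneg hΛ _))
    _ = N₀ * A * Λ ^ (k - j) * τ ^ (B.K - j) := by ring

/-- **TWO-RATE COROLLARY** (v1.1): counts `N j k ≤ N₀·Λ^{k−j}` (positions under a k-cube) and sizes carrying BOTH a
birth-distance gain and a final-distance decay, `σ j k ≤ A·φ^{k−j}·τ^{K−j}` (`N₀, A, Λ, φ, τ ≥ 0`, `τ ≤ 1`,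
`Λφτ ≤ 1`), nonnegative weights of total `≤ W`, give the budget `(N₀·A)·W` at every cube — through
`T4TubeBudget.tubeBudget_of_rate` with the combined rate `Λφ`.  (Cell reading G-pv16g4-7 (β2): `(Λ, φ, τ) = (L⁴, φ, θ₁)`
for the first-order NE1′ sizes; `(L⁴, 1, θ₁²)`-type data for the absorbed quadratic cost need `L⁴θ₁² ≤ 1` instead —
whether the printed rates meet these products is NOT asserted here.) [folklore] -/
theorem cubeBudget_of_twoRate {N σ : ℕ → ℕ → ℝ} {w : ℕ → ℝ} {N₀ A Λ φ τ W : ℝ} (hw : ∀ j ≤ B.K, 0 ≤ w j)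
    (hW : ∑ j ∈ range (B.K + 1), w j ≤ W) (hN : B.PositionalCount N) (hσ : B.SizeBound σ)
    (hσ0 : ∀ j k, 0 ≤ σ j k) (hN₀ : 0 ≤ N₀) (hA : 0 ≤ A) (hΛ : 0 ≤ Λ) (hφ : 0 ≤ φ)
    (hτ0 : 0 ≤ τ) (hτ1 : τ ≤ 1) (hΛφτ : Λ * φ * τ ≤ 1)
    (hNle : ∀ j k, j ≤ k → k ≤ B.K → N j k ≤ N₀ * Λ ^ (k - j))
    (hσle : ∀ j k, j ≤ k → k ≤ B.K → σ j k ≤ A * φ ^ (k - j) * τ ^ (B.K - j)) :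
    B.CubeBudget w ((N₀ * A) * W) := by
  refine cubeBudget_of_tubeBudget hw hN hσ hσ0 ?_
  refine T4TubeBudget.tubeBudget_of_rate hw hW (mul_nonneg hN₀ hA) (mul_nonneg hΛ hφ) hτ0 hτ1 hΛφτ ?_
  intro k hk j hjk
  calc N j k * σ j k ≤ (N₀ * Λ ^ (k - j)) * (A * φ ^ (k - j) * τ ^ (B.K - j)) :=
        mul_le_mul (hNle j k hjk hk) (hσle j k hjk hk) (hσ0 j k)
          (mul_nonneg hN₀ (pow_nonneg hΛ _))
    _ = N₀ * A * (Λ * φ) ^ (k - j) * τ ^ (B.K - j) := by rw [mul_pow]; ring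

/-- **THE INDUCTION SHAPE** rows O3.E-iii-b, -iii-c run: a bound at birth and one-step preservation give `SizeBound σ`.
[folklore] -/
theorem sizeBound_of_step {σ : ℕ → ℕ → ℝ}
    (h0 : ∀ b : B.Birth, B.size b (B.birthScale b) ≤ σ (B.birthScale b) (B.birthScale b))
    (hstep : ∀ (b : B.Birth) (k : ℕ), B.birthScale b ≤ k → k < B.K →
      B.size b k ≤ σ (B.birthScale b) k → B.size b (k + 1) ≤ σ (B.birthScale b) (k + 1)) :
    B.SizeBound σ := by
  intro b k hjk
  induction k, hjk using Nat.le_induction with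
  | base => exact fun _ => h0 b
  | succ k hjk ih => exact fun hk => hstep b k hjk (Nat.lt_of_succ_le hk) (ih (Nat.le_of_succ_le hk))

/-- BIRTH INPUT FROM ROW O3.E-i′: if the birth sizes are dominated by a scale array `s` obeying
`T4FirstOrderSize.SizeShape K s C w ρ` (e.g. `FirstOrderSize`, weight `g_j²R_j²`, rate `θ₁φ`), then the birth bound
`h0` of `sizeBound_of_step` holds with `σ j j = C · w j · ρ^{K−j}`. [folklore] -/
theorem birth_le_of_sizeShape {s : ℕ → ℝ} {C : ℝ} {w : ℕ → ℝ} {ρ : ℝ}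
    (hs : T4FirstOrderSize.SizeShape B.K s C w ρ) (hb : ∀ b : B.Birth, B.size b (B.birthScale b) ≤ |s (B.birthScale b)|)
    (b : B.Birth) : B.size b (B.birthScale b) ≤ C * w (B.birthScale b) * ρ ^ (B.K - B.birthScale b) :=
  (hb b).trans (hs _ (B.birth_le b))

/-- `SizeBound` is monotone in the bounding array. [folklore] -/
theorem SizeBound.mono {σ₁ σ₂ : ℕ → ℕ → ℝ} (h : B.SizeBound σ₁)
    (h12 : ∀ j k, j ≤ k → k ≤ B.K → σ₁ j k ≤ σ₂ j k) : B.SizeBound σ₂ :=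
  fun b k hjk hk => (h b k hjk hk).trans (h12 _ k hjk hk)

/-- `CubeBudget` is monotone in the constant. [folklore] -/
theorem CubeBudget.mono {w : ℕ → ℝ} {c₁ c₂ : ℝ} (h : B.CubeBudget w c₁) (hc : c₁ ≤ c₂) : B.CubeBudget w c₂ :=
  fun q => (h q).trans hc

/-- The load is nonnegative. [folklore] -/
theorem load_nonneg (q : B.Cube) (j : ℕ) : 0 ≤ B.load q j :=
  sum_nonneg fun b _ => B.size_nonneg b _

/-! ## §3 The pair class (O3.E-ii) and the quadratic-currency slot -/

variable (B)

/-- The births alive at scale `k` (born at a scale `≤ k`). [folklore] -/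
def alive (k : ℕ) : Finset B.Birth :=
  B.births.filter (fun b => B.birthScale b ≤ k)

/-- HYPOTHESIS SHAPE — MAYER SMALLNESS of the pair class (X2 obligation (A) / T4-REF-O3 V5 (iii): "sup_{X₁}Σ_{X₂}|v₁₂|·
(weights) ≪ 1" in place of tree decay between distant partners): at every scale `k ≤ K`, for every alive birth `b`,
`Σ_{b′ alive} |pair b b′ k| · u b′ ≤ ε`.  Cell analysis, NOT PRINTED (B13 as printed has no decay-free pair class).
[folklore] -/
def MayerSmall (u : B.Birth → ℝ) (ε : ℝ) : Prop :=
  ∀ k ≤ B.K, ∀ b ∈ B.alive k, ∑ b' ∈ B.alive k, |B.pair b b' k| * u b' ≤ ε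

/-- HYPOTHESIS SHAPE — THE QUADRATIC-CURRENCY SLOT: the (2.20) quadratic currency `η` drawn at cube `q` by the absorbed
linear parts of the terms felt there (`T4FirstOrderSize.LinearAbsorbed … η …`, row O3.E-i′) totals at most `η₀`
(row text O3.E-i′: "η ≤ O(1)α₄").  Cell analysis; the printed currency is (2.20). [cite: Balaban1988RG2Cluster, (2.20) p. 16] -/
def EtaBudget (η : B.Birth → ℕ → ℝ) (η₀ : ℝ) : Prop :=
  ∀ q : B.Cube, ∑ b ∈ B.feltAt q, η b (B.cubeScale q) ≤ η₀

variable {B}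

/-- Membership in `alive`. [folklore] -/
theorem mem_alive {k : ℕ} {b : B.Birth} : b ∈ B.alive k ↔ B.birthScale b ≤ k := by
  simp [alive, B.mem_births b]

/-- Births felt at a cube are alive at its scale. [folklore] -/
theorem feltAt_subset_alive (q : B.Cube) : B.feltAt q ⊆ B.alive (B.cubeScale q) :=
  fun b hb => mem_alive.mpr (B.felt_birth_le q b hb)

/-- `MayerSmall` is monotone in `ε` and antitone in the pair strengths. [folklore] -/
theorem MayerSmall.mono {u : B.Birth → ℝ} {ε₁ ε₂ : ℝ} (h : B.MayerSmall u ε₁) (hε : ε₁ ≤ ε₂) :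
    B.MayerSmall u ε₂ :=
  fun k hk b hb => (h k hk b hb).trans hε

/-- The currency slot from per-term draws bounded by a profile of the birth scale and positional counts:
`EtaBudget η (Σ_{j ≤ K}… )` — precisely, if `η b k ≤ e (birthScale b)` with `e ≥ 0` then the draw at a cube of scale
`k` is at most `Σ_{j ≤ k} N j k · e j`, so any uniform bound `E` of these sums is an `EtaBudget`. [folklore] -/
theorem etaBudget_of_count {N : ℕ → ℕ → ℝ} {η : B.Birth → ℕ → ℝ} {e : ℕ → ℝ} {E : ℝ} (hN : B.PositionalCount N)
    (hη : ∀ b k, B.birthScale b ≤ k → k ≤ B.K → η b k ≤ e (B.birthScale b)) (he : ∀ j, 0 ≤ e j)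
    (hE : ∀ k ≤ B.K, ∑ j ∈ range (k + 1), N j k * e j ≤ E) : B.EtaBudget η E := by
  intro q
  refine (sum_feltAt_le hN q (fun b => η b (B.cubeScale q)) e (fun b hb => ?_) he).trans
    (hE _ (B.cube_le q))
  exact hη b _ (B.felt_birth_le q b hb) (B.cube_le q)

/-! ## §4 The carrier shape (V4 (β)) with the μ-analyticity slot -/

variable (B)

/-- THE CARRIER SHAPE of D-terms (T4-REF-O3 V4 (β), cell analysis; a TYPE, nothing asserted): for each birth `b`, a type
of scale-j fluctuation configurations on X_i^L, a type of block-field-tower configurations above X_i^L with a DOMAIN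
slot (the analyticity domains — [Balaban1987RG1] U^c_j(X, α₀, α₁) p. 262, [Balaban1989LargeFieldII] (1.65) p. 375 — as an
abstract set), the value `val b μ ψ τ ∈ ℂ` of the term at coupling parameter `μ`, and a radius `μ₀ > 0`. [folklore] -/
structure Carrier where
  /-- fluctuation configurations on `X_i^L` at the birth scale -/
  Fluc : B.Birth → Type
  /-- block-field tower configurations above `X_i^L` -/
  Tower : B.Birth → Type
  /-- the analyticity-domain slot -/
  towerDom : (b : B.Birth) → Set (Tower b)
  /-- the value of the D-term born at `b`, as a function of `μ`, the fluctuation and the tower -/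
  val : (b : B.Birth) → ℂ → Fluc b → Tower b → ℂ
  /-- the μ-radius slot -/
  μ₀ : ℝ
  μ₀_pos : 0 < μ₀

variable {B}

/-- HYPOTHESIS SHAPE — THE μ-ANALYTICITY SLOT: for every birth, fluctuation and tower configuration in the domain,
`μ ↦ val b μ ψ τ` is complex-differentiable on the open ball of radius `μ₀` (T4-DAG O3b(i): D-terms analytic in μ;
radius bookkeeping is row O4.K).  A predicate, NOT asserted. [folklore] -/
def Carrier.MuAnalytic (C : B.Carrier) : Prop :=
  ∀ (b : B.Birth) (ψ : C.Fluc b) (τ : C.Tower b), τ ∈ C.towerDom b →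
    DifferentiableOn ℂ (fun μ => C.val b μ ψ τ) (Metric.ball 0 C.μ₀)

/-- HYPOTHESIS SHAPE — BIRTH SIZE DOMINATES THE CARRIER: on the domain and the μ-ball, `‖val b μ ψ τ‖ ≤ size b (birthScale b)`
(the link between the abstract size array at birth and the carrier; later-scale sizes refer to re-expanded pieces and are
NOT linked here — rows O3.E-iii-b, -iii-c). [folklore] -/
def Carrier.BirthSizeDominates (C : B.Carrier) : Prop :=
  ∀ (b : B.Birth) (μ : ℂ) (ψ : C.Fluc b) (τ : C.Tower b), τ ∈ C.towerDom b → ‖μ‖ < C.μ₀ →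
    ‖C.val b μ ψ τ‖ ≤ B.size b (B.birthScale b)

/-- Under `BirthSizeDominates` and `SizeBound σ`, carrier values at birth are bounded by the array: `‖val‖ ≤ σ j j`.
[folklore] -/
theorem Carrier.norm_val_le {C : B.Carrier} {σ : ℕ → ℕ → ℝ} (hC : C.BirthSizeDominates) (hσ : B.SizeBound σ)
    (b : B.Birth) {μ : ℂ} (ψ : C.Fluc b) {τ : C.Tower b} (hτ : τ ∈ C.towerDom b) (hμ : ‖μ‖ < C.μ₀) :
    ‖C.val b μ ψ τ‖ ≤ σ (B.birthScale b) (B.birthScale b) :=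
  (hC b μ ψ τ hτ hμ).trans (hσ b _ le_rfl (B.birth_le b))

/-! ## §4b (v1.2) The later-scale carrier — XREAD C-pv27-20 (d2)/(d3); v1.3: format point O-G3′ said once (docstring of
`CarrierAt`, text only) -/

variable (B)

/-- THE LATER-SCALE CARRIER (v1.2; suggested by the cross-read C-pv27-20 (d2) as the function-level home rows
O3.E-iii-b, -iii-c need; a TYPE, nothing asserted): on top of the birth carrier, for each birth `b` and each scale `k`
a type `FlucAt b k` of the then-current fluctuation variables on the few `k`-cubes of the branch (T4-REF-O3 V4 (α)),
the value `valAt b k μ ψ τ` of the (re-expanded) term at scale `k`, and an identification of scale `birthScale b` with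
the birth data.  BOOKING CONVENTION RECOMMENDED by C-pv27-20 (d3)(A) (the format allows both): a remainder regenerated at
step `k → k+1` from the term born at `b` is booked INSIDE `valAt b (k+1)` / `size b (k+1)` (weight `w (birthScale b)` in
`CubeBudget`, as (TOB-k) indexes births), not as a new birth.  FORMAT POINT O-G3′ (v1.3, GAPS G-pv28g5-6, record
`t4/T4-XREAD-O3Eiiib-G3.md` §3; option (i) CHOSEN, consistent with convention (A)): the regenerated pieces make birth
`b`'s family at scale `k+1` a `D_{k+1}`-indexed sum `Σ_X E^{(k+1)}_{D_b,1}(X)` of localised analytic pieces with RELATIVE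
tail `e^{−κ(d(X) − d(Ȳ_b))}`; `valAt b (k+1)` IS that X-sum — ONE function localised «at `Ȳ_b` up to an `e^{−κΔd}`
tail» (admissible as Lemma-1 input per G-pv28g5-6's located reading: print's E-terms carry the same tail,
[Balaban1988RG2Cluster] (1.31)/(1.32) p. 9), the relative-decay bookkeeping being O-G2′'s; the pieces are NOT
re-indexed by `(b, X)`, so `PositionalCount` is not regenerated and -G2 (T4) stands as booked.  Text only; no field
changes. [folklore] -/
structure CarrierAt extends Carrier B where
  /-- fluctuation variables of scale `k` seen by the term born at `b` -/
  FlucAt : B.Birth → ℕ → Type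
  /-- the value of the term born at `b`, re-expanded at scale `k` -/
  valAt : (b : B.Birth) → (k : ℕ) → ℂ → FlucAt b k → Tower b → ℂ
  /-- at the birth scale the fluctuation variables are the birth ones -/
  flucAtBirth : (b : B.Birth) → Fluc b ≃ FlucAt b (B.birthScale b)
  /-- and the value is the birth value -/
  valAt_birth : ∀ (b : B.Birth) (μ : ℂ) (ψ : Fluc b) (τ : Tower b),
    valAt b (B.birthScale b) μ (flucAtBirth b ψ) τ = val b μ ψ τ

variable {B}

/-- HYPOTHESIS SHAPE — μ-ANALYTICITY AT EVERY SCALE of the branch (`birthScale b ≤ k ≤ K`), on the domain and the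
μ-ball.  NOT asserted. [folklore] -/
def CarrierAt.MuAnalyticAt (C : B.CarrierAt) : Prop :=
  ∀ (b : B.Birth) (k : ℕ), B.birthScale b ≤ k → k ≤ B.K → ∀ (ψ : C.FlucAt b k) (τ : C.Tower b), τ ∈ C.towerDom b →
    DifferentiableOn ℂ (fun μ => C.valAt b k μ ψ τ) (Metric.ball 0 C.μ₀)

/-- HYPOTHESIS SHAPE — a FUNCTION-LEVEL NORM BOUND by an array `σ (birth scale) (current scale)` along the branch.
[folklore] -/
def CarrierAt.NormBound (C : B.CarrierAt) (σ : ℕ → ℕ → ℝ) : Prop :=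
  ∀ (b : B.Birth) (k : ℕ), B.birthScale b ≤ k → k ≤ B.K → ∀ (μ : ℂ) (ψ : C.FlucAt b k) (τ : C.Tower b),
    τ ∈ C.towerDom b → ‖μ‖ < C.μ₀ → ‖C.valAt b k μ ψ τ‖ ≤ σ (B.birthScale b) k

/-- HYPOTHESIS SHAPE — THE SIZE ARRAY DOMINATES THE CARRIER AT EVERY SCALE (the later-scale link v1 left open,
G-pv16g4-8 (2)): `‖valAt b k μ ψ τ‖ ≤ size b k`. [folklore] -/
def CarrierAt.SizeDominatesAt (C : B.CarrierAt) : Prop :=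
  ∀ (b : B.Birth) (k : ℕ), B.birthScale b ≤ k → k ≤ B.K → ∀ (μ : ℂ) (ψ : C.FlucAt b k) (τ : C.Tower b),
    τ ∈ C.towerDom b → ‖μ‖ < C.μ₀ → ‖C.valAt b k μ ψ τ‖ ≤ B.size b k

/-- HYPOTHESIS SHAPE — THE ONE-STEP OPERATOR BOUND rows -iii-b, -iii-c must supply (the T-step / a later ℝ-step as a
map from scale-`k` values to scale-`(k+1)` values whose bound carries `σ _ k` to `σ _ (k+1)`): if the scale-`k` values of
the term born at `b` are bounded by `σ (birthScale b) k` on domain × ball, so are the scale-`(k+1)` values by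
`σ (birthScale b) (k+1)`.  The natural suppliers are the osc-currency sandwich (`T4OscSandwich`, `T4DressedR`) and the
(2.20) currency (`EtaBudget`, `T4FirstOrderSize.LinearAbsorbed`) — named, not imported.  NOT asserted. [folklore] -/
def CarrierAt.OneStepBound (C : B.CarrierAt) (σ : ℕ → ℕ → ℝ) : Prop :=
  ∀ (b : B.Birth) (k : ℕ), B.birthScale b ≤ k → k < B.K →
    (∀ (μ : ℂ) (ψ : C.FlucAt b k) (τ : C.Tower b), τ ∈ C.towerDom b → ‖μ‖ < C.μ₀ →
      ‖C.valAt b k μ ψ τ‖ ≤ σ (B.birthScale b) k) →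
    ∀ (μ : ℂ) (ψ : C.FlucAt b (k + 1)) (τ : C.Tower b), τ ∈ C.towerDom b → ‖μ‖ < C.μ₀ →
      ‖C.valAt b (k + 1) μ ψ τ‖ ≤ σ (B.birthScale b) (k + 1)

/-- A norm bound at every scale restricts to the v1 birth-level statement through the identification.
[folklore] -/
theorem CarrierAt.birthSizeDominates_of_sizeDominatesAt {C : B.CarrierAt} (h : C.SizeDominatesAt) :
    C.toCarrier.BirthSizeDominates := by
  intro b μ ψ τ hτ hμ
  have h1 := h b (B.birthScale b) le_rfl (B.birth_le b) μ (C.flucAtBirth b ψ) τ hτ hμ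
  rw [C.valAt_birth] at h1
  exact h1

/-- **THE FUNCTION-LEVEL INDUCTION** (mirror of `sizeBound_of_step`): a birth-level bound `‖val b‖ ≤ σ j j` and the
one-step operator bound give the norm bound `‖valAt b k‖ ≤ σ j k` along the whole branch. [folklore] -/
theorem CarrierAt.normBound_of_step {C : B.CarrierAt} {σ : ℕ → ℕ → ℝ}
    (h0 : ∀ (b : B.Birth) (μ : ℂ) (ψ : C.Fluc b) (τ : C.Tower b), τ ∈ C.towerDom b → ‖μ‖ < C.μ₀ →
      ‖C.val b μ ψ τ‖ ≤ σ (B.birthScale b) (B.birthScale b))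
    (hstep : C.OneStepBound σ) : C.NormBound σ := by
  intro b k hjk hkK
  induction k, hjk using Nat.le_induction with
  | base =>
      intro μ ψ τ hτ hμ
      have e : ψ = C.flucAtBirth b ((C.flucAtBirth b).symm ψ) := by simp
      rw [e, C.valAt_birth]
      exact h0 b μ _ τ hτ hμ
  | succ k hjk ih =>
      exact hstep b k hjk (Nat.lt_of_succ_le hkK) (ih (Nat.le_of_succ_le hkK))

/-- With `SizeBound σ` for the array and `SizeDominatesAt`, carrier values obey `‖valAt b k‖ ≤ σ (birthScale b) k`
at every scale of the branch. [folklore] -/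
theorem CarrierAt.norm_valAt_le {C : B.CarrierAt} {σ : ℕ → ℕ → ℝ} (hC : C.SizeDominatesAt) (hσ : B.SizeBound σ)
    (b : B.Birth) {k : ℕ} (hjk : B.birthScale b ≤ k) (hk : k ≤ B.K) {μ : ℂ} (ψ : C.FlucAt b k) {τ : C.Tower b}
    (hτ : τ ∈ C.towerDom b) (hμ : ‖μ‖ < C.μ₀) : ‖C.valAt b k μ ψ τ‖ ≤ σ (B.birthScale b) k :=
  (hC b k hjk hk μ ψ τ hτ hμ).trans (hσ b k hjk hk)

/-! ## §5 Non-vacuity: the empty booking -/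

/-- THE EMPTY BOOKING at final scale `K`: no D-term births, one dummy domain and one dummy cube per instance of the data
(sizes of Bałaban's own terms set to `0`).  For non-vacuity of the predicates only. [folklore] -/
def vacuum (K : ℕ) : Booking where
  K := K
  Dom := Unit
  domScale := fun _ => 0
  treeLen := fun _ => 0
  treeLen_nonneg := fun _ => le_rfl
  balSize := fun _ => 0
  Birth := PEmpty
  births := ∅
  mem_births := fun b => nomatch b
  birthScale := fun b => nomatch b
  birth_le := fun b => nomatch b
  loc := fun b => nomatch b
  loc_scale := fun b => nomatch b
  Cube := Unit
  cubes := {()}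
  mem_cubes := fun q => by simp
  cubeScale := fun _ => K
  cube_le := fun _ => le_rfl
  feltAt := fun _ => ∅
  felt_birth_le := fun _ b _ => nomatch b
  size := fun b => nomatch b
  size_nonneg := fun b => nomatch b
  pair := fun b => nomatch b

/-- The empty booking meets the budget with constant `0` for any weights. [folklore] -/
theorem vacuum_cubeBudget (K : ℕ) (w : ℕ → ℝ) : (vacuum K).CubeBudget w 0 := by
  intro q
  have h : ∀ j, (vacuum K).load q j = 0 := fun j => by simp [load, feltOfScale, vacuum]
  simp [h]

/-- The empty booking has factor format with `E₀ = 0` (its `balSize` is `0`). [folklore] -/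
theorem vacuum_factorFormat (K : ℕ) (κ : ℝ) : (vacuum K).FactorFormat 0 κ := by
  intro X; simp [vacuum]

/-- The empty booking is Mayer-small with `ε = 0` and meets any currency slot with `η₀ = 0`. [folklore] -/
theorem vacuum_mayerSmall_etaBudget (K : ℕ) (u : (vacuum K).Birth → ℝ) (η : (vacuum K).Birth → ℕ → ℝ) :
    (vacuum K).MayerSmall u 0 ∧ (vacuum K).EtaBudget η 0 :=
  ⟨fun _ _ b _ => (nomatch b), fun q => by simp [vacuum]⟩

end Booking

end Literature.MathematicalPhysics.QuantumFieldTheory.Balaban1983to89.T4TermFormat
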